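import Mathlib
import HarnessLib
import Summits.AtomisticToContinuum.Statement
import Summits.AtomisticToContinuum.Crystallization.Theses.OverbindingBudget
import Summits.AtomisticToContinuum.Crystallization.Theorems.OverbindingBudgetRecurrenceDividend

/-!
# OverbindingBudget — exact ⟹ relaxed gapped-twelve test (registered stub `stub_relaxedOfExact` of line «IsolatedDefectSurgery» on
`RobustDefectLimitWindows`, stmt-AtomisticToContinuum-31280; decomp-a2c-lens-4 gen 8)

A site passing the EXACT gapped-twelve test at spacing `a` (exactly twelve points of `Y ∖ {y}` within `a(1+1/50)`, every other point at
distance `≥ a(1-1/50)` and outside the open gap `(a(1+1/50), a·63/50)`) passes the `t`-RELAXED test for every margin `t ≥ 0`.  The only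
non-trivial input is the finiteness of shells in a uniformly discrete set (`finite_shell`, `finite_shell'` of
`Theorems.OverbindingBudgetRecurrenceDividend`), which makes `Set.ncard` monotone.  [folklore]
-/

namespace Summit.AtomisticToContinuum.Crystallization.Theorems.OverbindingBudgetRelaxedOfExact

open Literature.MathematicalPhysics.StatisticalMechanics
open Summit.AtomisticToContinuum.Crystallization.Theorems.OverbindingBudgetRecurrenceDividend (finite_shell finite_shell')

/-- **Exact ⟹ relaxed** (registered stub `stub_relaxedOfExact`, verbatim signature): the exact gapped-twelve test at spacing `a` implies the
`t`-relaxed test for every `t ≥ 0`. [folklore] -/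
theorem stub_relaxedOfExact :
    ∀ Y : Set (EuclideanSpace ℝ (Fin 3)), Literature.MathematicalPhysics.StatisticalMechanics.UniformlyDiscrete Y → ∀ a t : ℝ, 0 ≤ t → ∀ y : EuclideanSpace ℝ (Fin 3), ({w ∈ Y | w ≠ y ∧ dist y w ≤ a * (1 + 1 / 50)}.ncard = 12 ∧ ∀ w ∈ Y, w ≠ y → a * (1 - 1 / 50) ≤ dist y w ∧ (dist y w ≤ a * (1 + 1 / 50) ∨ a * (63 / 50) ≤ dist y w)) → ({w ∈ Y | w ≠ y ∧ dist y w < a * (63 / 50) - t}.ncard ≤ 12 ∧ 12 ≤ {w ∈ Y | w ≠ y ∧ dist y w ≤ a * (1 + 1 / 50) + t}.ncard ∧ ∀ w ∈ Y, w ≠ y → a * (1 - 1 / 50) - t ≤ dist y w ∧ (dist y w ≤ a * (1 + 1 / 50) + t ∨ a * (63 / 50) - t ≤ dist y w)) := by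
  intro Y hUD a t ht y h
  obtain ⟨hcard, hsh⟩ := h
  refine ⟨?_, ?_, fun w hw hwy => ?_⟩
  · have hsub : {w ∈ Y | w ≠ y ∧ dist y w < a * (63 / 50) - t} ⊆
        {w ∈ Y | w ≠ y ∧ dist y w ≤ a * (1 + 1 / 50)} := by
      intro w hw
      refine ⟨hw.1, hw.2.1, ?_⟩
      rcases (hsh w hw.1 hw.2.1).2 with h' | h'
      · exact h'
      · exfalso; linarith [hw.2.2]
    exact (Set.ncard_le_ncard hsub (finite_shell hUD y _)).trans hcard.le
  · have hsub : {w ∈ Y | w ≠ y ∧ dist y w ≤ a * (1 + 1 / 50)} ⊆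
        {w ∈ Y | w ≠ y ∧ dist y w ≤ a * (1 + 1 / 50) + t} := fun w hw =>
      ⟨hw.1, hw.2.1, by linarith [hw.2.2]⟩
    exact hcard.ge.trans (Set.ncard_le_ncard hsub (finite_shell hUD y _))
  · obtain ⟨h31, h32⟩ := hsh w hw hwy
    refine ⟨by linarith, ?_⟩
    rcases h32 with h' | h'
    · left; linarith
    · right; linarith

/-- Readable corollary: a `t`-robust violator (`t ≥ 0`) of the relaxed test is an exact violator. -/
theorem exactViolator_of_robustViolator {Y : Set (EuclideanSpace ℝ (Fin 3))} (hUD : UniformlyDiscrete Y) {a t : ℝ} (ht : 0 ≤ t)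
    {y : EuclideanSpace ℝ (Fin 3)}
    (hv : ¬ ({w ∈ Y | w ≠ y ∧ dist y w < a * (63 / 50) - t}.ncard ≤ 12 ∧
      12 ≤ {w ∈ Y | w ≠ y ∧ dist y w ≤ a * (1 + 1 / 50) + t}.ncard ∧
      ∀ w ∈ Y, w ≠ y → a * (1 - 1 / 50) - t ≤ dist y w ∧ (dist y w ≤ a * (1 + 1 / 50) + t ∨ a * (63 / 50) - t ≤ dist y w))) :
    ¬ ({w ∈ Y | w ≠ y ∧ dist y w ≤ a * (1 + 1 / 50)}.ncard = 12 ∧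
      ∀ w ∈ Y, w ≠ y → a * (1 - 1 / 50) ≤ dist y w ∧ (dist y w ≤ a * (1 + 1 / 50) ∨ a * (63 / 50) ≤ dist y w)) :=
  fun h => hv (stub_relaxedOfExact Y hUD a t ht y h)

end Summit.AtomisticToContinuum.Crystallization.Theorems.OverbindingBudgetRelaxedOfExact
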